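import Summits.NavierStokesRegularity.NavierStokesRegularity.Theorems.LerayQuarterDissipationFiniteDissipationLiouvilleCalmSliceLeaf
import Summits.NavierStokesRegularity.NavierStokesRegularity.Theorems.LerayQuarterDissipationFiniteDissipationLiouvilleLocalSelfSimilarity
import Literature.Analysis.FluidPDE.ExteriorDeRham
import HarnessLib

/-!
# Crux `FiniteDissipationLiouville` (stmt-NavierStokesRegularity-22144): the calm-slice leaf
# LOCALISED IN SPACE — the unsteadiness of a slice is real-analytic, so ONE calm parabolic
# sub-ball anywhere forces regularity; the flicker of a finite-dissipation Type-I singularity is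
# spatially dense at every instant

Theorems file of route `LerayQuarterDissipation` (lead prover g14; `--supports` the crux; portrait
facts for the registered stub `stub_envelopeCriticalLiouville` of skeleton v27/v28). Navier–Stokes
regularity is NOT proved by anything here; no summit is. `𝒟_{C,K}` = Type-I ancient mild fields in
the KNSS gauge (`IsTypeIAncientMild C`) with the quarter-rate dissipation law
`∫‖∇w(s)‖² ≤ K/√(−s)`. The UNSTEADINESS of `w` at `(t,x)`, `t < 0`, is the route's vector
`√(−t) • ((−t)∂ₜw − ½w − ½(x·∇)w)(t,x)` (`= ∂ₛU` of the similarity profile; at `t = −1` it is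
`G(y) = ∂ₜw(−1,y) − ½w(−1,y) − ½Dw(−1)(y)[y]`).

What the tree had (acknowledged): the calm-slice leaf `CalmSlice.calmSlice_leaf` (= sister route
`CalmSliceGate.OneCalmSlice`, stmt-24375: unsteadiness `≤ δ(C,K)` on the similarity ball
`B(0, R(C,K)√(−t))` at ONE instant ⇒ regular — the radius `R` is CHOSEN BY THE THEOREM),
Pineau–Vicol's explicit floor on the unit ball (`Envelope.pv_unsteadiness_floor_of_minimal`), the
weak-steadiness Liouville `CalmSlice.slice_eq_zero_of_weakUnsteadiness_eq_zero` (tests on ALL of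
`ℝ³`), and lead g13's open-set generator Liouville in SPACE-TIME
(`ReturnTimes.eq_zero_of_scalingGenerator_eq_zero_nhds`), whose census left the ONE-SLICE open-set
form undone. New here:

* `analyticOnNhd_unsteadiness` — the unsteadiness field `G` of the slice `−1` of a class member is
  REAL-ANALYTIC on `ℝ³` (it is `−½×` the slice of g13's jointly analytic scaling generator,
  `ReturnTimes.analyticOnNhd_scalingGenerator` + `scalingGenerator_eq`).
* `fderiv_unsteadiness_symm_of_weakSteady_on` — if the (derivative-free) weak unsteadiness
  functional of the slice vanishes on the solenoidal tests supported in ONE non-empty open set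
  `U`, then `DG` is symmetric EVERYWHERE (local de Rham `ExteriorDeRham.inner_fderiv_comm_…_on` on
  `U` + identity theorem for the analytic entries of `DG − DGᵀ`).
* `slice_eq_zero_of_fderiv_unsteadiness_symm` — a member of `𝒟` whose slice has `curl G = 0`
  (symmetric `DG`) has zero slice (segment potential `G = ∇π`, Leray's profile system for
  `(U, p+π)`, `U ∈ L⁶`, Tsai 1998; the tail of the CalmSlice proof, entered one step later).
* `slice_eq_zero_of_weakSteady_on`, `slice_eq_zero_of_unsteadiness_eq_zero_on` — **LOCAL
  INSTANTANEOUS SELF-SIMILARITY KILLS**: weak steadiness on ONE ball, or `G = 0` on ONE non-empty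
  open set of ONE slice, forces the slice of a member of `𝒟` to vanish;
  `eq_zero_of_unsteadiness_eq_zero_on`: at any instant `t₀`, hence (forward uniqueness
  `CalmSlice.eq_zero_after_zero_slice` + g13's space-time open-set Liouville) `w ≡ 0` on the whole
  past. This is the one-slice form g13's census asked for, in its law-using version (the law enters
  only through `U ∈ L⁶` for Tsai's theorem).
* `localCalm_leaf` — **ONE CALM PARABOLIC SUB-BALL ANYWHERE ⇒ REGULAR**: for all `C, K`, every
  similarity radius `ρ ≥ 0` and every sub-ball radius `r > 0` there is `δ = δ(C,K,ρ,r) > 0` such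
  that a member of `𝒟_{C,K}` with unsteadiness `≤ δ` on ONE ball `B(x₀, r√(−t))`,
  `‖x₀‖ ≤ ρ√(−t)`, at ONE instant `t < 0` is regular at the apex (KNSS compactness across members,
  Bolzano for the centres, persistence of the singularity, the law of the limit, continuity of the
  weak unsteadiness along pointwise limits, and the local weak-steadiness Liouville above).
* `localFlicker_floor_of_singular` — PORTRAIT: **the flicker of a finite-dissipation Type-I
  singularity is SPATIALLY DENSE**: at every instant and in every parabolic sub-ball
  `B(x₀, r√(−t))` of the similarity region `‖x₀‖ ≤ ρ√(−t)` the unsteadiness exceeds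
  `δ(C,K,ρ,r)` somewhere — no calm pocket of any parabolic size, uniformly on the stratum (DSS and
  wandering members alike). `finiteDissipationLiouville_iff_localFlicker`: bookkeeping.

HONEST FRAMING: portrait facts; `δ` comes from compactness (ineffective) and degrades as
`ρ → ∞` or `r → 0` (far from the apex the profile IS nearly steady: `∂ₛŨ₀ = −½ΛŨ₀ → 0` at spatial
infinity for the final datum seen in similarity variables). Nothing is removed for the DSS wall;
the crux stays blocked on `∀ c > 1, TypeIDSSLiouville c` (NECESSARY, `…Hardness`).
presearch: local / open-set steadiness Liouville for Leray's backward similarity profiles → none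
in print beyond Tsai 1998 (global profile equation) and Pineau–Vicol 2026 Thm 1.9 (one calm slice
on the unit ball); corpus hybrid+vec, galaxy all (2026-08-28).

References: T.-P. Tsai, ARMA 143 (1998) Thm 1; B. Pineau, V. Vicol, arXiv:2607.09619 (2026) Thm 1.9
and §1.3; Koch–Nadirashvili–Seregin–Šverák, Acta Math. 203 (2009) = arXiv:0709.3599 §4;
Lemarié-Rieusset (2016) Thm 9.12; Galdi, Lemma III.1.1 (de Rham).
-/

noncomputable section

-- the summit and its single sub-problem share the name (CONVENTIONS §1), as in every Theorems file
set_option linter.dupNamespace false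

namespace Summit.NavierStokesRegularity.NavierStokesRegularity.Theorems.FiniteDissipationLiouville.CalmSliceLocal

open MeasureTheory Set Filter Topology Metric Function TopologicalSpace InnerProductSpace
open Literature.Analysis Literature.Analysis.FluidPDE
open Summit.NavierStokesRegularity.NavierStokesRegularity.Theorems
open Summit.NavierStokesRegularity.NavierStokesRegularity.Theorems.FiniteDissipationLiouville
open Summit.NavierStokesRegularity.NavierStokesRegularity.Theorems.FiniteDissipationLiouville.CalmSlice
open Summit.NavierStokesRegularity.NavierStokesRegularity.Theorems.FiniteDissipationLiouville.ReturnTimes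
open scoped ENNReal NNReal RealInnerProductSpace Laplacian ContDiff

/-! ### The unsteadiness of a slice is real-analytic -/

/-- **The unsteadiness field of a slice is real-analytic.** For a Type-I ancient mild field `w`
(KNSS gauge), `y ↦ ∂ₜw(−1,y) − ½ w(−1,y) − ½ Dw(−1)(y)[y]` is real-analytic on `ℝ³`: it is `−½` times
the slice `t = −1` of the jointly analytic scaling generator `w + x·∇w + 2t∂ₜw`
(`ReturnTimes.analyticOnNhd_scalingGenerator`, Lemarié-Rieusset 2016 Thm 9.12 through the proved
local analyticity of Oseen's scheme). [cite: LemarieRieusset2016, Thm. 9.12 (PDF p. 260)] -/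
theorem analyticOnNhd_unsteadiness {C : ℝ}
    {w : ℝ → EuclideanSpace ℝ (Fin 3) → EuclideanSpace ℝ (Fin 3)} (hw : IsTypeIAncientMild C w) :
    AnalyticOnNhd ℝ (fun y => deriv (fun τ => w τ y) (-1) - (1 / 2 : ℝ) • w (-1) y -
      (1 / 2 : ℝ) • fderiv ℝ (w (-1)) y y) univ := by
  have hgen := analyticOnNhd_scalingGenerator hw
  -- the slice `-1` of the analytic generator
  have hsl : AnalyticOnNhd ℝ (fun y : EuclideanSpace ℝ (Fin 3) =>
      w (-1) y + fderiv ℝ (uncurry w) ((-1 : ℝ), y)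
        ((2 * (-1 : ℝ), y) : ℝ × EuclideanSpace ℝ (Fin 3))) univ := by
    intro y _
    have hmem : ((-1 : ℝ), y) ∈ Iio (0 : ℝ) ×ˢ (univ : Set (EuclideanSpace ℝ (Fin 3))) :=
      ⟨by norm_num, mem_univ _⟩
    exact (hgen _ hmem).curry_right
  have e : (fun y => deriv (fun τ => w τ y) (-1) - (1 / 2 : ℝ) • w (-1) y -
      (1 / 2 : ℝ) • fderiv ℝ (w (-1)) y y) = (-(1 / 2 : ℝ)) • fun y => (w (-1) y +
        fderiv ℝ (uncurry w) ((-1 : ℝ), y) ((2 * (-1 : ℝ), y) : ℝ × EuclideanSpace ℝ (Fin 3))) := by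
    funext y
    rw [Pi.smul_apply, scalingGenerator_eq hw (by norm_num : (-1 : ℝ) < 0) y]
    module
  rw [e]
  exact fun y hy => (hsl y hy).const_smul

/-! ### Local weak steadiness forces a symmetric derivative everywhere -/

/-- **Local weak steadiness ⇒ `curl G = 0` on all of `ℝ³`.** Let `w` be Type-I ancient mild and
suppose the derivative-free weak unsteadiness functional of its slice `U = w(−1,·)`,
`ψ ↦ ∫ (⟪U,(U·∇)ψ⟫ + ⟪U,Δψ⟫ + ⟪U,ψ⟫ + ½⟪U,(y·∇)ψ⟫)`, vanishes on every smooth solenoidal `ψ`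
compactly supported in ONE non-empty open set `O`. Then the derivative of the unsteadiness field
`G` is symmetric at EVERY point of `ℝ³`: on `O` by the momentum equation (the functional is
`∫⟪G,ψ⟫`, `CalmSlice.integral_inner_unsteadiness_eq`) and local de Rham
(`ExteriorDeRham.inner_fderiv_comm_of_forall_integral_inner_eq_zero_on`); everywhere because the
entries of `DG − DGᵀ` are real-analytic (`analyticOnNhd_unsteadiness`) and vanish on `O`
(identity theorem). [cite: Galdi2011, Lemma III.1.1] -/
theorem fderiv_unsteadiness_symm_of_weakSteady_on {C : ℝ}
    {w : ℝ → EuclideanSpace ℝ (Fin 3) → EuclideanSpace ℝ (Fin 3)} (hw : IsTypeIAncientMild C w)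
    {O : Set (EuclideanSpace ℝ (Fin 3))} (hO : IsOpen O) (hne : O.Nonempty)
    (hweak : ∀ ψ : EuclideanSpace ℝ (Fin 3) → EuclideanSpace ℝ (Fin 3), ContDiff ℝ ∞ ψ →
      HasCompactSupport ψ → tsupport ψ ⊆ O → VectorCalculus.IsDivFree ψ →
      ∫ y, (⟪w (-1) y, convect (w (-1)) ψ y⟫ + ⟪w (-1) y, (Δ ψ) y⟫ + ⟪w (-1) y, ψ y⟫ +
        (1 / 2 : ℝ) * ⟪w (-1) y, fderiv ℝ ψ y y⟫) = 0)
    (x v v' : EuclideanSpace ℝ (Fin 3)) :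
    ⟪fderiv ℝ (fun y => deriv (fun τ => w τ y) (-1) - (1 / 2 : ℝ) • w (-1) y -
        (1 / 2 : ℝ) • fderiv ℝ (w (-1)) y y) x v, v'⟫ =
      ⟪fderiv ℝ (fun y => deriv (fun τ => w τ y) (-1) - (1 / 2 : ℝ) • w (-1) y -
        (1 / 2 : ℝ) • fderiv ℝ (w (-1)) y y) x v', v⟫ := by
  set G : EuclideanSpace ℝ (Fin 3) → EuclideanSpace ℝ (Fin 3) := fun y =>
    deriv (fun τ => w τ y) (-1) - (1 / 2 : ℝ) • w (-1) y - (1 / 2 : ℝ) • fderiv ℝ (w (-1)) y y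
    with hGdef
  have hG : ContDiff ℝ ∞ G := contDiff_unsteadiness hw
  have hGa : AnalyticOnNhd ℝ G univ := analyticOnNhd_unsteadiness hw
  -- ### orthogonality to the solenoidal tests supported in `O`
  have horth : ∀ φ : EuclideanSpace ℝ (Fin 3) → EuclideanSpace ℝ (Fin 3),
      FunctionSpaces.IsTestFunctionOn ⟨O, hO⟩ φ →
      (∀ y, VectorCalculus.divergence φ y = 0) → ∫ y, ⟪G y, φ y⟫ = 0 := by
    intro φ hφ hdiv
    have hdiv' : VectorCalculus.IsDivFree φ := hdiv
    rw [hGdef, integral_inner_unsteadiness_eq hw (contDiff_infty.1 hφ.contDiff 2)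
      hφ.hasCompactSupport hdiv']
    exact hweak φ hφ.contDiff hφ.hasCompactSupport hφ.tsupport_subset hdiv'
  -- ### local de Rham on `O`
  have hloc : ∀ y ∈ O, ∀ a b : EuclideanSpace ℝ (Fin 3),
      ⟪fderiv ℝ G y a, b⟫ = ⟪fderiv ℝ G y b, a⟫ := fun y hy a b =>
    ExteriorDeRham.inner_fderiv_comm_of_forall_integral_inner_eq_zero_on hO hG horth hy a b
  -- ### analytic continuation of the antisymmetric part
  have hD : AnalyticOnNhd ℝ (fderiv ℝ G) univ := hGa.fderiv
  have hent : ∀ a b : EuclideanSpace ℝ (Fin 3),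
      AnalyticOnNhd ℝ (fun y => ⟪b, fderiv ℝ G y a⟫) univ := by
    intro a b
    have h2 : AnalyticOnNhd ℝ (fun y => fderiv ℝ G y a) univ :=
      (ContinuousLinearMap.apply ℝ (EuclideanSpace ℝ (Fin 3)) a).comp_analyticOnNhd hD
    exact (innerSL ℝ b).comp_analyticOnNhd h2
  set m : EuclideanSpace ℝ (Fin 3) → ℝ := fun y => ⟪v', fderiv ℝ G y v⟫ - ⟪v, fderiv ℝ G y v'⟫
    with hmdef
  have hm : AnalyticOnNhd ℝ m univ := (hent v v').sub (hent v' v)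
  obtain ⟨z₀, hz₀⟩ := hne
  have hev : m =ᶠ[𝓝 z₀] 0 := by
    filter_upwards [hO.mem_nhds hz₀] with y hy
    show ⟪v', fderiv ℝ G y v⟫ - ⟪v, fderiv ℝ G y v'⟫ = 0
    rw [real_inner_comm (fderiv ℝ G y v) v', real_inner_comm (fderiv ℝ G y v') v, hloc y hy v v',
      sub_self]
  have hzero : m x = 0 :=
    hm.eqOn_zero_of_preconnected_of_eventuallyEq_zero (convex_univ).isPreconnected (mem_univ z₀)
      hev (mem_univ x)
  change ⟪v', fderiv ℝ G x v⟫ - ⟪v, fderiv ℝ G x v'⟫ = 0 at hzero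
  have h' : ⟪v', fderiv ℝ G x v⟫ = ⟪v, fderiv ℝ G x v'⟫ := sub_eq_zero.1 hzero
  rw [real_inner_comm v' (fderiv ℝ G x v), real_inner_comm v (fderiv ℝ G x v')]
  exact h'

/-! ### A slice with curl-free unsteadiness vanishes -/

/-- **A member of the stratum whose slice has curl-free unsteadiness vanishes at that slice.** Let
`w ∈ 𝒟_{C,K}` and suppose the derivative of the unsteadiness field `G` of the slice `−1` is
symmetric everywhere. Then `w(−1,·) = 0`: `G = ∇π` for the segment potential
(`hasGradientAt_segmentIntegral`), so `(U, p(−1) + π)` solves LERAY'S PROFILE SYSTEM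
`−ΔU + ½U + ½(y·∇)U + (U·∇)U + ∇P = 0`, `div U = 0` with a `C¹` pressure, and `U ∈ L⁶`
(`Birth.memLp_six_slice`), so Tsai's Liouville theorem applies (adapted from
`CalmSlice.slice_eq_zero_of_weakUnsteadiness_eq_zero`, entered one step later). [cite: Tsai1998, Theorem 1 (p. 31)] -/
theorem slice_eq_zero_of_fderiv_unsteadiness_symm {C K : ℝ}
    {w : ℝ → EuclideanSpace ℝ (Fin 3) → EuclideanSpace ℝ (Fin 3)}
    (hw : IsTypeIAncientMild C w)
    (hlaw : ∀ s : ℝ, s < 0 → ∫⁻ x, ‖fderiv ℝ (w s) x‖ₑ ^ 2 ≤ ENNReal.ofReal (K / Real.sqrt (-s)))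
    (hsymm : ∀ x v v' : EuclideanSpace ℝ (Fin 3),
      ⟪fderiv ℝ (fun y => deriv (fun τ => w τ y) (-1) - (1 / 2 : ℝ) • w (-1) y -
          (1 / 2 : ℝ) • fderiv ℝ (w (-1)) y y) x v, v'⟫ =
        ⟪fderiv ℝ (fun y => deriv (fun τ => w τ y) (-1) - (1 / 2 : ℝ) • w (-1) y -
          (1 / 2 : ℝ) • fderiv ℝ (w (-1)) y y) x v', v⟫) :
    ∀ x, w (-1) x = 0 := by
  -- adapted from `CalmSlice.slice_eq_zero_of_weakUnsteadiness_eq_zero` (Theorems/…CalmSliceWeak)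
  obtain ⟨p, hcl⟩ := hw.exists_isClassicalNSSolutionOn_Ioo (t₀ := -2) (by norm_num)
  have hm : (-1 : ℝ) ∈ Ioo (-2 : ℝ) 0 := by norm_num
  set U : EuclideanSpace ℝ (Fin 3) → EuclideanSpace ℝ (Fin 3) := w (-1) with hUdef
  set G : EuclideanSpace ℝ (Fin 3) → EuclideanSpace ℝ (Fin 3) := fun y =>
    deriv (fun τ => w τ y) (-1) - (1 / 2 : ℝ) • w (-1) y - (1 / 2 : ℝ) • fderiv ℝ (w (-1)) y y
    with hGdef
  have hG : ContDiff ℝ ∞ G := contDiff_unsteadiness hw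
  -- Poincaré: `G = ∇π`
  set π : EuclideanSpace ℝ (Fin 3) → ℝ := fun y => ∫ σ in (0 : ℝ)..1, ⟪G (σ • y), y⟫ with hπdef
  have hπ : ∀ y, HasGradientAt π (G y) y := fun y => hasGradientAt_segmentIntegral hG hsymm y
  have hπF : ∀ y, HasFDerivAt π (toDual ℝ (EuclideanSpace ℝ (Fin 3)) (G y)) y := fun y =>
    (hπ y).hasFDerivAt
  have hπd : Differentiable ℝ π := fun y => (hπF y).differentiableAt
  have hπ1 : ContDiff ℝ 1 π := by
    rw [contDiff_one_iff_fderiv]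
    refine ⟨hπd, ?_⟩
    have e : fderiv ℝ π = fun y => toDual ℝ (EuclideanSpace ℝ (Fin 3)) (G y) :=
      funext fun y => (hπF y).fderiv
    rw [e]
    exact (toDual ℝ (EuclideanSpace ℝ (Fin 3))).continuous.comp hG.continuous
  -- the Leray profile system for `(U, p(-1) + π)`
  have hU : ContDiff ℝ ∞ U := hcl.contDiff_velocity hm
  have hp : ContDiff ℝ ∞ (p (-1)) := hcl.contDiff_pressure hm
  have hp1 : ContDiff ℝ 1 (p (-1)) := contDiff_infty.1 hp 1
  have hgradP : ∀ y, gradient (fun z => p (-1) z + π z) y = gradient (p (-1)) y + G y := by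
    intro y
    have h1 : HasFDerivAt (p (-1))
        (toDual ℝ (EuclideanSpace ℝ (Fin 3)) (gradient (p (-1)) y)) y :=
      ((hp1.differentiable one_ne_zero) y).hasGradientAt.hasFDerivAt
    have h2 : HasGradientAt (fun z => p (-1) z + π z) (gradient (p (-1)) y + G y) y := by
      rw [hasGradientAt_iff_hasFDerivAt, map_add]
      exact h1.add (hπF y)
    exact h2.gradient
  have hmom : ∀ y, deriv (fun τ => w τ y) (-1) + convect U U y =
      (1 : ℝ) • (Δ U) y - gradient (p (-1)) y := by
    intro y
    have := hcl.momentum (-1) hm y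
    rw [← deriv_time_eq_timeDerivWithin (w := w) y] at this
    simpa only [Pi.zero_apply, add_zero] using this
  have hprof : IsLerayProfile 1 (1 / 2 : ℝ) U (fun z => p (-1) z + π z) := by
    refine ⟨contDiff_infty.1 hU 2, hp1.add hπ1, fun y => ?_, hw.isDivFree (by norm_num)⟩
    rw [hgradP y]
    have hGy : G y = deriv (fun τ => w τ y) (-1) - (1 / 2 : ℝ) • U y -
        (1 / 2 : ℝ) • fderiv ℝ U y y := rfl
    rw [hGy]
    have := hmom y
    rw [one_smul] at this ⊢
    rw [← sub_eq_zero] at this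
    rw [← this]
    abel
  -- `U ∈ L⁶` and Tsai's Liouville theorem
  obtain ⟨CL, -, hL6⟩ := Birth.memLp_six_slice
  have hU6 : MemLp U 6 volume := (hL6 C K w hw hlaw (-1) (by norm_num)).1
  have hzero : U = 0 := tsai_selfsimilar_holds one_pos (by norm_num) hprof (q := 6)
    (by norm_num) (by simp) hU6
  intro x
  simpa [hUdef] using congrFun hzero x

/-! ### Local instantaneous self-similarity kills -/

/-- **WEAK STEADINESS ON ONE BALL KILLS THE SLICE.** A member of `𝒟_{C,K}` whose slice `−1` has
vanishing weak unsteadiness against the smooth solenoidal tests supported in ONE non-empty open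
set `O ⊆ ℝ³` has zero slice: `w(−1,·) = 0` on all of `ℝ³` (symmetric `DG` everywhere by
`fderiv_unsteadiness_symm_of_weakSteady_on`, then `slice_eq_zero_of_fderiv_unsteadiness_symm`).
The tree's `CalmSlice.slice_eq_zero_of_weakUnsteadiness_eq_zero` is the case `O = ℝ³`. [cite: Tsai1998, Theorem 1 (p. 31)] -/
theorem slice_eq_zero_of_weakSteady_on {C K : ℝ}
    {w : ℝ → EuclideanSpace ℝ (Fin 3) → EuclideanSpace ℝ (Fin 3)}
    (hw : IsTypeIAncientMild C w)
    (hlaw : ∀ s : ℝ, s < 0 → ∫⁻ x, ‖fderiv ℝ (w s) x‖ₑ ^ 2 ≤ ENNReal.ofReal (K / Real.sqrt (-s)))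
    {O : Set (EuclideanSpace ℝ (Fin 3))} (hO : IsOpen O) (hne : O.Nonempty)
    (hweak : ∀ ψ : EuclideanSpace ℝ (Fin 3) → EuclideanSpace ℝ (Fin 3), ContDiff ℝ ∞ ψ →
      HasCompactSupport ψ → tsupport ψ ⊆ O → VectorCalculus.IsDivFree ψ →
      ∫ y, (⟪w (-1) y, convect (w (-1)) ψ y⟫ + ⟪w (-1) y, (Δ ψ) y⟫ + ⟪w (-1) y, ψ y⟫ +
        (1 / 2 : ℝ) * ⟪w (-1) y, fderiv ℝ ψ y y⟫) = 0) :
    ∀ x, w (-1) x = 0 :=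
  slice_eq_zero_of_fderiv_unsteadiness_symm hw hlaw
    (fderiv_unsteadiness_symm_of_weakSteady_on hw hO hne hweak)

/-- **POINTWISE STEADINESS ON ONE OPEN SET KILLS THE SLICE.** A member of `𝒟_{C,K}` whose
unsteadiness field `∂ₜw(−1,·) − ½w(−1,·) − ½Dw(−1)[y]` vanishes on ONE non-empty open subset of
ONE slice has zero slice (the field is real-analytic, `analyticOnNhd_unsteadiness`, so it vanishes
on `ℝ³`; then `CalmSlice.slice_eq_zero_of_weakUnsteadiness_eq_zero`). In similarity variables: a
backward profile that is instantaneously self-similar on an open set of space at one similarity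
time is trivial. [cite: Tsai1998, Theorem 1 (p. 31)] -/
theorem slice_eq_zero_of_unsteadiness_eq_zero_on {C K : ℝ}
    {w : ℝ → EuclideanSpace ℝ (Fin 3) → EuclideanSpace ℝ (Fin 3)}
    (hw : IsTypeIAncientMild C w)
    (hlaw : ∀ s : ℝ, s < 0 → ∫⁻ x, ‖fderiv ℝ (w s) x‖ₑ ^ 2 ≤ ENNReal.ofReal (K / Real.sqrt (-s)))
    {O : Set (EuclideanSpace ℝ (Fin 3))} (hO : IsOpen O) (hne : O.Nonempty)
    (hG : ∀ y ∈ O, deriv (fun τ => w τ y) (-1) - (1 / 2 : ℝ) • w (-1) y -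
      (1 / 2 : ℝ) • fderiv ℝ (w (-1)) y y = 0) :
    ∀ x, w (-1) x = 0 := by
  set G : EuclideanSpace ℝ (Fin 3) → EuclideanSpace ℝ (Fin 3) := fun y =>
    deriv (fun τ => w τ y) (-1) - (1 / 2 : ℝ) • w (-1) y - (1 / 2 : ℝ) • fderiv ℝ (w (-1)) y y
    with hGdef
  have hGa : AnalyticOnNhd ℝ G univ := analyticOnNhd_unsteadiness hw
  obtain ⟨z₀, hz₀⟩ := hne
  have hev : G =ᶠ[𝓝 z₀] 0 := by
    filter_upwards [hO.mem_nhds hz₀] with y hy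
    exact hG y hy
  have hzero : ∀ y, G y = 0 := fun y =>
    hGa.eqOn_zero_of_preconnected_of_eventuallyEq_zero (convex_univ).isPreconnected (mem_univ z₀)
      hev (mem_univ y)
  refine slice_eq_zero_of_weakUnsteadiness_eq_zero hw hlaw fun ψ hψ hc hdiv => ?_
  rw [← integral_inner_unsteadiness_eq hw (contDiff_infty.1 hψ 2) hc hdiv]
  have hint : (fun y => ⟪G y, ψ y⟫) = fun _ => (0 : ℝ) := by
    funext y; rw [hzero y, inner_zero_left]
  change ∫ y, (fun y => ⟪G y, ψ y⟫) y = 0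
  rw [hint, integral_zero]

/-- **ONE LOCALLY SELF-SIMILAR INSTANT KILLS A MEMBER OF THE STRATUM ON THE WHOLE PAST.** If at ONE
instant `t₀ < 0` the unsteadiness `(−t₀)∂ₜw − ½w − ½(x·∇)w` of a member of `𝒟_{C,K}` vanishes on
ONE non-empty open set of space, then `w ≡ 0` on `t < 0`: rescale `t₀` to `−1`
(`CalmSlice.unsteadiness_nsRescale`), kill the slice (`slice_eq_zero_of_unsteadiness_eq_zero_on`),
propagate forward (`CalmSlice.eq_zero_after_zero_slice`), and continue backward through the open
space-time set where the scaling generator now vanishes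
(`ReturnTimes.eq_zero_of_scalingGenerator_eq_zero_nhds`, lead g13). [cite: Tsai1998, Theorem 1 (p. 31)] -/
theorem eq_zero_of_unsteadiness_eq_zero_on {C K : ℝ}
    {w : ℝ → EuclideanSpace ℝ (Fin 3) → EuclideanSpace ℝ (Fin 3)}
    (hw : IsTypeIAncientMild C w)
    (hlaw : ∀ s : ℝ, s < 0 → ∫⁻ x, ‖fderiv ℝ (w s) x‖ₑ ^ 2 ≤ ENNReal.ofReal (K / Real.sqrt (-s)))
    {t₀ : ℝ} (ht₀ : t₀ < 0) {O : Set (EuclideanSpace ℝ (Fin 3))} (hO : IsOpen O) (hne : O.Nonempty)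
    (hG : ∀ x ∈ O, (-t₀) • deriv (fun τ => w τ x) t₀ - (1 / 2 : ℝ) • w t₀ x -
      (1 / 2 : ℝ) • fderiv ℝ (w t₀) x x = 0) :
    ∀ t < 0, ∀ x, w t x = 0 := by
  -- ### rescale the instant `t₀` to `-1`
  set μ : ℝ := Real.sqrt (-t₀) with hμdef
  have hμ : 0 < μ := Real.sqrt_pos.2 (neg_pos.2 ht₀)
  have hμ2 : μ ^ 2 = -t₀ := by rw [hμdef, Real.sq_sqrt (neg_nonneg.2 ht₀.le)]
  set v : ℝ → EuclideanSpace ℝ (Fin 3) → EuclideanSpace ℝ (Fin 3) := nsRescale μ w with hvdef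
  have hv : IsTypeIAncientMild C v := isTypeIAncientMild_nsRescale hw hμ
  have hvlaw := RecurrentReductionD.dissipationLaw_nsRescale hlaw hμ
  -- the pulled-back open set
  set O' : Set (EuclideanSpace ℝ (Fin 3)) := (fun y : EuclideanSpace ℝ (Fin 3) => μ • y) ⁻¹' O
    with hO'def
  have hO' : IsOpen O' := hO.preimage (continuous_const_smul μ)
  have hne' : O'.Nonempty := by
    obtain ⟨x₀, hx₀⟩ := hne
    refine ⟨μ⁻¹ • x₀, ?_⟩
    rw [hO'def, mem_preimage, smul_smul, mul_inv_cancel₀ hμ.ne', one_smul]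
    exact hx₀
  -- the slice `-1` of `v` is steady on `O'`
  have hG' : ∀ y ∈ O', deriv (fun τ => v τ y) (-1) - (1 / 2 : ℝ) • v (-1) y -
      (1 / 2 : ℝ) • fderiv ℝ (v (-1)) y y = 0 := by
    intro y hy
    rw [hvdef, hμdef, unsteadiness_nsRescale hw ht₀ y, hG (Real.sqrt (-t₀) • y) hy, smul_zero]
  have hslice : ∀ y, v (-1) y = 0 := slice_eq_zero_of_unsteadiness_eq_zero_on hv hvlaw hO' hne' hG'
  -- ### forward: `v = 0` on `(-1, 0) × ℝ³`
  have hfw : ∀ t ∈ Ioo (-1 : ℝ) 0, ∀ y, v t y = 0 := fun t ht y =>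
    eq_zero_after_zero_slice hv hslice ht y
  -- ### backward: the scaling generator vanishes near `(-1/2, 0)`, so `v ≡ 0` on the past
  have hpast : ∀ t < 0, ∀ y, v t y = 0 := by
    have hp : ((-(1 / 2 : ℝ), (0 : EuclideanSpace ℝ (Fin 3))) : ℝ × EuclideanSpace ℝ (Fin 3)).1 < 0 := by
      norm_num
    refine eq_zero_of_scalingGenerator_eq_zero_nhds hv hp ?_
    have hS : Ioo (-1 : ℝ) 0 ×ˢ (univ : Set (EuclideanSpace ℝ (Fin 3))) ∈
        𝓝 ((-(1 / 2 : ℝ), (0 : EuclideanSpace ℝ (Fin 3))) : ℝ × EuclideanSpace ℝ (Fin 3)) :=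
      (isOpen_Ioo.prod isOpen_univ).mem_nhds ⟨by norm_num, mem_univ _⟩
    filter_upwards [hS] with z hz
    have hz1 : z.1 ∈ Ioo (-1 : ℝ) 0 := hz.1
    have hslz : v z.1 = fun _ => (0 : EuclideanSpace ℝ (Fin 3)) := funext fun y => hfw z.1 hz1 y
    have hder : deriv (fun s => v s z.2) z.1 = 0 := by
      have hev : (fun s => v s z.2) =ᶠ[𝓝 z.1] fun _ => (0 : EuclideanSpace ℝ (Fin 3)) := by
        filter_upwards [isOpen_Ioo.mem_nhds hz1] with s hs
        exact hfw s hs z.2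
      rw [hev.deriv_eq, deriv_const]
    rw [hder, smul_zero, add_zero, hslz]
    simp
  -- ### back to `w`
  intro t ht x
  have hμ2pos : 0 < μ ^ 2 := by positivity
  have e : v (t / μ ^ 2) (μ⁻¹ • x) = μ • w t x := by
    rw [hvdef, nsRescale_apply, mul_div_cancel₀ _ hμ2pos.ne', smul_smul, mul_inv_cancel₀ hμ.ne',
      one_smul]
  have h0 : μ • w t x = 0 := by
    rw [← e]
    exact hpast _ (div_neg_of_neg_of_pos ht hμ2pos) _
  exact (smul_eq_zero.1 h0).resolve_left hμ.ne'

/-- **Not-singular form** of `eq_zero_of_unsteadiness_eq_zero_on` (for the portrait). -/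
theorem not_singular_of_unsteadiness_eq_zero_on {C K : ℝ}
    {w : ℝ → EuclideanSpace ℝ (Fin 3) → EuclideanSpace ℝ (Fin 3)}
    (hw : IsTypeIAncientMild C w)
    (hlaw : ∀ s : ℝ, s < 0 → ∫⁻ x, ‖fderiv ℝ (w s) x‖ₑ ^ 2 ≤ ENNReal.ofReal (K / Real.sqrt (-s)))
    {t₀ : ℝ} (ht₀ : t₀ < 0) {O : Set (EuclideanSpace ℝ (Fin 3))} (hO : IsOpen O) (hne : O.Nonempty)
    (hG : ∀ x ∈ O, (-t₀) • deriv (fun τ => w τ x) t₀ - (1 / 2 : ℝ) • w t₀ x -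
      (1 / 2 : ℝ) • fderiv ℝ (w t₀) x x = 0) :
    ¬ (∀ r > 0, ∀ M : ℝ, ∃ t ∈ Set.Ioo (-(r ^ 2)) (0 : ℝ),
        ∃ x ∈ Metric.ball (0 : EuclideanSpace ℝ (Fin 3)) r, M < ‖w t x‖) := by
  intro hsing
  obtain ⟨t, ht, x, -, hM⟩ := hsing 1 one_pos 0
  rw [eq_zero_of_unsteadiness_eq_zero_on hw hlaw ht₀ hO hne hG t ht.2 x, norm_zero] at hM
  exact lt_irrefl _ hM

end Summit.NavierStokesRegularity.NavierStokesRegularity.Theorems.FiniteDissipationLiouville.CalmSliceLocal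

end
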